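import Summits.Ventures.DiscreteObjects.PP12.FixedPointsEqFixedLines
import Summits.Ventures.DiscreteObjects.PP12.Involution

/-!
# Orbit structure of a prime-order collineation: as many line-cycles as point-cycles (kernel; sizes of the orbit matrices)
Framing: lottery ticket; floor = certified bounds/negative ranges.

For a permutation `τ` of a finite type with `τ ^ p = 1`, `p` prime, every non-trivial cycle has length `p`, so
`#support τ = p · (number of cycles)` (`card_support_eq_mul_card_cycleType`). For a collineation `σ` of a finite projective plane
with `σ ^ p = 1` on points, Baer's equality (`fixedCard_points_eq_lines`, p223195) and `|P| = |L|` then give: the number of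
`p`-cycles of `σ` on lines equals that on points (`card_cycleType_points_eq_lines`). Hence the orbit (tactical) decomposition of
`⟨σ⟩` has as many line orbits as point orbits, `f + (v − f)/p` of each (fixed points + cycles) — the sizes 85 / 61 / 53–59 quoted
for the live PP(12) cells in the census table (cell pub-namedobj, target M) are kernel facts given the kernel values of `f`.
-/

namespace Summit.Ventures.DiscreteObjects.PP12

open Configuration Finset

section Perm

variable {α : Type*} [Fintype α] [DecidableEq α]

/-- If `τ ^ p = 1` with `p` prime, every cycle of `τ` has length `p`. -/
theorem mem_cycleType_eq_of_pow_prime {p : ℕ} (hp : p.Prime) {τ : Equiv.Perm α} (hτ : τ ^ p = 1) {n : ℕ}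
    (hn : n ∈ τ.cycleType) : n = p := by
  have h1 : n ∣ orderOf τ := Equiv.Perm.dvd_of_mem_cycleType hn
  have h2 : orderOf τ ∣ p := orderOf_dvd_of_pow_eq_one hτ
  have h3 : n ∣ p := dvd_trans h1 h2
  have h4 := Equiv.Perm.two_le_of_mem_cycleType hn
  rcases (Nat.dvd_prime hp).mp h3 with h | h
  · omega
  · exact h

/-- If `τ ^ p = 1` with `p` prime: `#support τ = p · #cycles`. -/
theorem card_support_eq_mul_card_cycleType {p : ℕ} (hp : p.Prime) {τ : Equiv.Perm α} (hτ : τ ^ p = 1) :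
    τ.support.card = p * Multiset.card τ.cycleType := by
  have hrep : τ.cycleType = Multiset.replicate (Multiset.card τ.cycleType) p :=
    Multiset.eq_replicate_card.mpr fun n hn => mem_cycleType_eq_of_pow_prime hp hτ hn
  rw [← Equiv.Perm.sum_cycleType, hrep, Multiset.sum_replicate, smul_eq_mul, Multiset.card_replicate, mul_comm]

/-- Fixed points and support partition the type: `fixedCard τ + #support τ = |α|`. -/
theorem fixedCard_add_card_support (τ : Equiv.Perm α) : fixedCard τ + τ.support.card = Fintype.card α := by
  rw [fixedCard_eq_card_compl_support, Finset.card_compl]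
  have := Finset.card_le_univ τ.support
  omega

end Perm

namespace Collineation

variable {P L : Type*} [Membership P L] [ProjectivePlane P L] [Fintype P] [Fintype L]
  [DecidableEq P] [DecidableEq L] (σ : Collineation P L)

/-- **Orbit matrices are square.** For a collineation with `σ ^ p = 1` on points (`p` prime), the number of `p`-cycles on lines
equals the number of `p`-cycles on points; with Baer's equality of fixed points and fixed lines, the numbers of `⟨σ⟩`-orbits on
points and on lines agree. -/
theorem card_cycleType_points_eq_lines {p : ℕ} (hp : p.Prime) (hq : σ.onPoints ^ p = 1) :
    Multiset.card σ.onLines.cycleType = Multiset.card σ.onPoints.cycleType := by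
  have hqL : σ.onLines ^ p = 1 := σ.onLines_pow_eq_one hq
  have h1 := card_support_eq_mul_card_cycleType hp hq
  have h2 := card_support_eq_mul_card_cycleType hp hqL
  have h3 := fixedCard_add_card_support σ.onPoints
  have h4 := fixedCard_add_card_support σ.onLines
  have h5 := σ.fixedCard_points_eq_lines
  rw [ProjectivePlane.card_points P L] at h3
  rw [ProjectivePlane.card_lines P L] at h4
  have h6 : p * Multiset.card σ.onLines.cycleType = p * Multiset.card σ.onPoints.cycleType := by omega
  exact Nat.eq_of_mul_eq_mul_left hp.pos h6

/-- Order 12, involution: exactly 72 two-cycles on points and 72 on lines (orbit matrix 85 × 85 with the 13 + 13 fixed elements). -/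
theorem cycles_of_sq_order12 (h12 : ProjectivePlane.order P L = 12) (hne : σ.onPoints ≠ 1) (hq : σ.onPoints ^ 2 = 1) :
    Multiset.card σ.onPoints.cycleType = 72 ∧ Multiset.card σ.onLines.cycleType = 72 := by
  classical
  have h1 := card_support_eq_mul_card_cycleType Nat.prime_two hq
  have h3 := fixedCard_add_card_support σ.onPoints
  rw [ProjectivePlane.card_points P L, h12, (σ.fixedCard_eq_13_of_sq h12 hne hq).1] at h3
  have hP : Multiset.card σ.onPoints.cycleType = 72 := by omega
  exact ⟨hP, by rw [σ.card_cycleType_points_eq_lines Nat.prime_two hq, hP]⟩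

/-- Order 12, `σ³ = 1`: the number of 3-cycles on points (= on lines) is `(157 − f)/3` with `f` the number of fixed points. -/
theorem cycles_of_cube_order12 (h12 : ProjectivePlane.order P L = 12) (hq : σ.onPoints ^ 3 = 1) :
    3 * Multiset.card σ.onPoints.cycleType + fixedCard σ.onPoints = 157 ∧
    Multiset.card σ.onLines.cycleType = Multiset.card σ.onPoints.cycleType := by
  have h1 := card_support_eq_mul_card_cycleType Nat.prime_three hq
  have h3 := fixedCard_add_card_support σ.onPoints
  rw [ProjectivePlane.card_points P L, h12] at h3
  exact ⟨by omega, σ.card_cycleType_points_eq_lines Nat.prime_three hq⟩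

end Collineation

end Summit.Ventures.DiscreteObjects.PP12
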